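import Literature.NumberTheory.Transcendental.KZSemiCanonicalReductionProofs
import Literature.NumberTheory.Transcendental.KZDominatedFamilyRelations
import Literature.NumberTheory.Transcendental.KZLogCalculusProofs

/-!
# `FiveTermTransfer` (stmt-KontsevichZagierPeriods-3469) — line `valuation-kernel-sweep`,
stub `stub_valuationKernel`

The **valuation (kernel) property** of the Kontsevich–Zagier calculus of moves
(`Literature/NumberTheory/Transcendental/KZCalculus.lean`), a consequence of rule (1) alone: a
`ℤ`-combination `∑ cᵢ [rᵢ]` of integral representations of one dimension `n` whose integrands agree
with one common function `g` on their domains `σᵢ`, and whose signed indicator `∑ cᵢ 𝟙_{σᵢ}`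
vanishes almost everywhere, is a relation.

Proof. Refine every domain to the Boolean atoms `A_S = {p | ∀ j, p ∈ σⱼ ↔ j ∈ S}` (`S ⊆ Fin k`;
all `ℚ`-semialgebraic): `σᵢ` is the disjoint union of the `A_S` with `i ∈ S`, so
`[rᵢ] ≡ ∑_{S ∋ i} [rᵢ|A_S]` by iterated domain additivity (`KZ.of_sub_sum_of_mem_relations`).
After swapping the two sums, on a fixed atom `A_S` all the pieces `[rᵢ|A_S]` (`i ∈ S`) carry the
integrand `g`, hence are congruent (`KZ.of_sub_of_mem_relations_of_eqOn`) to one of them,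
`[r_{i₀}|A_S]`, and the atom contributes `(∑_{i ∈ S} cᵢ) • [r_{i₀}|A_S]`: a null atom is a relation
(`KZ.of_mem_relations_of_volume_eq_zero`), and on an atom of positive measure the a.e. hypothesis,
evaluated at one point of the atom, reads `∑_{i ∈ S} cᵢ = 0`.

References: M. Kontsevich, D. Zagier, *Periods* (2001), §1.2, rule (1).
-/

noncomputable section

open MeasureTheory Set

namespace Summit.KontsevichZagierPeriods.HyperbolicBloch.FiveTerm

open Literature.NumberTheory.Transcendental
open Literature.NumberTheory.Transcendental.KZ
open Literature.ModelTheory.ExponentialFields (IsSemialgebraic)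

variable {n k : ℕ}

/-- The Boolean atom `{p | ∀ i, p ∈ σᵢ ↔ i ∈ S}` of finitely many `ℚ`-semialgebraic domains is
`ℚ`-semialgebraic (a finite intersection of domains and complements of domains). [folklore] -/
private theorem isSemialgebraic_atom (r : Fin k → KZ.IntegralRep n) (S : Finset (Fin k)) :
    IsSemialgebraic ℚ {p : Fin n → ℝ | ∀ i, p ∈ (r i).domain ↔ i ∈ S} := by
  have e : {p : Fin n → ℝ | ∀ i, p ∈ (r i).domain ↔ i ∈ S} =
      (⋂ i ∈ S, (r i).domain) ∩ ⋂ i ∈ Sᶜ, ((r i).domain)ᶜ := by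
    ext p
    simp only [mem_setOf_eq, mem_inter_iff, mem_iInter, mem_compl_iff, Finset.mem_compl]
    exact ⟨fun h => ⟨fun i hi => (h i).2 hi, fun i hi hp => hi ((h i).1 hp)⟩,
      fun h i => ⟨fun hp => by_contra fun hi => h.2 i hi hp, h.1 i⟩⟩
  rw [e]
  exact (IsSemialgebraic.biInter S _ fun i _ => (r i).isSemialgebraic_domain).inter
    (IsSemialgebraic.biInter Sᶜ _ fun i _ => (r i).isSemialgebraic_domain.compl)

/-- **Refinement to the atoms** (iterated rule (1a)): if `R i S` is the restriction of `r i` to the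
atom `A_S ∩ σᵢ`, then `[r i] − ∑_{S ∋ i} [R i S] ∈ relations`, the atoms `A_S` with `i ∈ S` being
pairwise disjoint with union exactly `σᵢ` (`KZ.of_sub_sum_of_mem_relations`, all defects empty).
[folklore] -/
private theorem of_sub_sum_atoms_mem_relations (r : Fin k → KZ.IntegralRep n)
    (R : Fin k → Finset (Fin k) → KZ.IntegralRep n)
    (hRd : ∀ i S, (R i S).domain = {p | ∀ j, p ∈ (r j).domain ↔ j ∈ S} ∩ (r i).domain)
    (hRi : ∀ i S, (R i S).integrand = (r i).integrand) (i : Fin k) :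
    KZ.of (r i) - ∑ S ∈ Finset.univ.filter (fun S => i ∈ S), KZ.of (R i S) ∈ KZ.relations := by
  classical
  refine KZ.of_sub_sum_of_mem_relations _ (r i) (R i) (fun S _ => ?_) (fun S _ => ?_) ?_ ?_
  · rw [hRd, Set.sdiff_eq_empty.mpr inter_subset_right, measure_empty]
  · rw [hRi]
    exact fun _ _ => rfl
  · rw [Set.sdiff_eq_empty.mpr fun p hp => ?_, measure_empty]
    simp only [mem_iUnion, exists_prop, Finset.mem_filter, Finset.mem_univ, true_and]
    refine ⟨Finset.univ.filter (fun j => p ∈ (r j).domain), by simpa using hp, ?_⟩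
    rw [hRd]
    exact ⟨fun j => by simp, hp⟩
  · intro S _ S' _ hSS'
    have he : (R i S).domain ∩ (R i S').domain = ∅ := by
      rw [hRd, hRd]
      refine eq_empty_of_forall_notMem fun p hp => hSS' ?_
      ext j
      exact (hp.1.1 j).symm.trans (hp.2.1 j)
    rw [he, measure_empty]

/-- **One atom.** On the atom `A_S` all the pieces `R i S` (`i ∈ S`) have the same domain and the
same integrand `g`, so they are congruent to `R i₀ S` for any `i₀ ∈ S`
(`KZ.of_sub_of_mem_relations_of_eqOn`), and `∑_{i ∈ S} cᵢ • [R i S] ≡ (∑_{i ∈ S} cᵢ) • [R i₀ S]`;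
the latter is a relation, `A_S ∩ σ_{i₀}` being either null
(`KZ.of_mem_relations_of_volume_eq_zero`) or containing a point at which the a.e. identity reads
`∑_{i ∈ S} cᵢ = 0`. [folklore] -/
private theorem sum_atom_mem_relations (r : Fin k → KZ.IntegralRep n) (c : Fin k → ℤ)
    (g : (Fin n → ℝ) → ℝ) (hg : ∀ i, EqOn (r i).integrand g (r i).domain)
    (hae : ∀ᵐ p : Fin n → ℝ, ∑ i, (c i : ℝ) * (r i).domain.indicator (fun _ => (1 : ℝ)) p = 0)
    (R : Fin k → Finset (Fin k) → KZ.IntegralRep n)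
    (hRd : ∀ i S, (R i S).domain = {p | ∀ j, p ∈ (r j).domain ↔ j ∈ S} ∩ (r i).domain)
    (hRi : ∀ i S, (R i S).integrand = (r i).integrand) (S : Finset (Fin k)) :
    ∑ i ∈ S, c i • KZ.of (R i S) ∈ KZ.relations := by
  rcases S.eq_empty_or_nonempty with rfl | ⟨i₀, hi₀⟩
  · rw [Finset.sum_empty]
    exact KZ.relations.zero_mem
  -- all the pieces on the atom are congruent to the `i₀`-th one
  have hcong : ∀ i ∈ S, KZ.of (R i S) - KZ.of (R i₀ S) ∈ KZ.relations := by
    intro i hi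
    refine KZ.of_sub_of_mem_relations_of_eqOn ?_ fun p hp => ?_
    · rw [hRd, hRd]
      ext p
      simp only [mem_inter_iff, mem_setOf_eq]
      exact ⟨fun h => ⟨h.1, (h.1 i).2 hi⟩, fun h => ⟨h.1, (h.1 i₀).2 hi₀⟩⟩
    · rw [hRd] at hp
      rw [hRi, hRi, hg i hp.2, hg i₀ ((hp.1 i₀).2 hi₀)]
  have h1 : ∑ i ∈ S, c i • KZ.of (R i S) - ∑ i ∈ S, c i • KZ.of (R i₀ S) ∈ KZ.relations :=
    KZ.sum_sub_sum_mem_relations S _ _ fun i hi => by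
      rw [← zsmul_sub]
      exact KZ.relations.zsmul_mem (hcong i hi) _
  have h2 : ∑ i ∈ S, c i • KZ.of (R i₀ S) ∈ KZ.relations := by
    rw [← Finset.sum_smul]
    by_cases hvol : volume (R i₀ S).domain = 0
    · exact KZ.relations.zsmul_mem (KZ.of_mem_relations_of_volume_eq_zero _ hvol) _
    · obtain ⟨p, hp, hp0⟩ :=
        Measure.exists_mem_of_measure_ne_zero_of_ae hvol (ae_restrict_of_ae hae)
      rw [hRd] at hp
      have hind : ∀ i, (r i).domain.indicator (fun _ => (1 : ℝ)) p = if i ∈ S then 1 else 0 := by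
        intro i
        by_cases hi : i ∈ S
        · rw [if_pos hi, indicator_of_mem ((hp.1 i).2 hi)]
        · rw [if_neg hi, indicator_of_notMem fun h => hi ((hp.1 i).1 h)]
      simp only [hind, mul_ite, mul_one, mul_zero, Finset.sum_ite_mem, Finset.univ_inter] at hp0
      have hc : ∑ i ∈ S, c i = 0 := by exact_mod_cast hp0
      rw [hc, zero_smul]
      exact KZ.relations.zero_mem
  have h := KZ.relations.add_mem h1 h2
  rwa [sub_add_cancel] at h

/-- **Kernel (valuation) lemma.** A `ℤ`-combination of representations of one dimension carrying a
common integrand, whose signed indicator function vanishes almost everywhere, is a KZ relation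
(refine to the Boolean atoms of the domains by rule (1a); on an atom of positive measure the
coefficients sum to `0`, a null atom is itself a relation). [folklore] -/
theorem stub_valuationKernel :
    ∀ (n k : ℕ) (r : Fin k → KZ.IntegralRep n) (c : Fin k → ℤ) (g : (Fin n → ℝ) → ℝ),
      (∀ i, Set.EqOn (r i).integrand g (r i).domain) →
      (∀ᵐ (p : Fin n → ℝ), ∑ i, (c i : ℝ) * (r i).domain.indicator (fun _ => (1 : ℝ)) p = 0) →
      ∑ i, c i • KZ.of (r i) ∈ KZ.relations := by
  intro n k r c g hg hae
  -- the pieces `R i S = r i` restricted to the atom `A_S ∩ σᵢ`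
  obtain ⟨R, hRd, hRi⟩ : ∃ R : Fin k → Finset (Fin k) → KZ.IntegralRep n,
      (∀ i S, (R i S).domain = {p | ∀ j, p ∈ (r j).domain ↔ j ∈ S} ∩ (r i).domain) ∧
      (∀ i S, (R i S).integrand = (r i).integrand) :=
    ⟨fun i S => (r i).restrict _ ((isSemialgebraic_atom r S).inter (r i).isSemialgebraic_domain)
      inter_subset_right, fun _ _ => rfl, fun _ _ => rfl⟩
  -- refine every `[r i]` to its atoms
  have h1 : ∑ i, c i • KZ.of (r i) -
      ∑ i, c i • ∑ S ∈ Finset.univ.filter (fun S => i ∈ S), KZ.of (R i S) ∈ KZ.relations :=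
    KZ.sum_sub_sum_mem_relations _ _ _ fun i _ => by
      rw [← zsmul_sub]
      exact KZ.relations.zsmul_mem (of_sub_sum_atoms_mem_relations r R hRd hRi i) _
  -- swap the sums and treat each atom
  have h2 : ∑ i, c i • ∑ S ∈ Finset.univ.filter (fun S => i ∈ S), KZ.of (R i S) ∈
      KZ.relations := by
    simp_rw [Finset.smul_sum]
    rw [Finset.sum_comm' (t' := Finset.univ) (s' := fun S => S) (fun i S => by simp)]
    exact sum_mem fun S _ => sum_atom_mem_relations r c g hg hae R hRd hRi S
  have h := KZ.relations.add_mem h1 h2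
  rwa [sub_add_cancel] at h

end Summit.KontsevichZagierPeriods.HyperbolicBloch.FiveTerm

end
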